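import Mathlib.Combinatorics.SimpleGraph.Maps
import Literature.Computability.Complexity.GraphEncodings
import Literature.Computability.Complexity.Classes
import HarnessLib

/-!
# Canonical forms of vertex-coloured graphs in moderately exponential time (Babai–Luks 1983)

A **canonical form** for a class of finite structures under isomorphism is a map `CF` with
`CF(X) ≅ X` and `X ≅ Y → CF(X) = CF(Y)`; it is in particular a complete isomorphism invariant.
Babai and Luks (STOC 1983) showed that canonical forms (indeed canonical labelings) of graphs
on `k` vertices can be computed in `exp(k^{1/2 + o(1)})` steps, matching the best isomorphism
TEST then known (Zemlyachenko–Luks–Babai); the method canonises with respect to an arbitrary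
given colouring of the vertices (canonical labeling cosets `CL(X, G)` for `G` a direct product
of symmetric groups, §3–4 of the paper), so vertex-coloured graphs are covered. Babai–Luks also
record (§1) that a purely combinatorial `c^k` canonisation was given by Corneil–Goldberg (1984).

This file states that theorem as a NAMED FACT over the tree's string-function time classes:

* `colGraphCode k G col` — the code of a vertex-coloured graph on `Fin k` (colours in `ℕ`):
  the pair of the graph code `encodingGraph.encode ⟨k, G⟩` (row-major adjacency matrix, so the
  code has length `≥ k²`) and the list of the `k` colours in binary (`encodingFinVec`).
* `ColIso k G₁ c₁ G₂ c₂` — colour-preserving isomorphism.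
* `babaiLuks1983_canonicalForm : Prop` — there are `c` and a string map `can`, computable in
  time `O(2^{c √N})` on inputs of length `N`, which on codes of vertex-coloured graphs is a
  canonical form: `can (code X)` is the code of a coloured graph isomorphic to `X`, and
  isomorphic inputs have equal images.

On the time bound. The paper's bound is `exp(C √(k log k)) · poly(N)` in terms of the number
`k` of vertices (after replacing the colours by their ranks, a polynomial-time preprocessing);
since `N ≥ k²` for our codes, this is at most `2^{O(√N)}` in terms of the input length alone,
which is the (weaker) form stated here because the tree's `FTIME` bounds time by input length
only. The weakening keeps exactly what moderately-exponential canonisation is used for: on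
graphs with `k = O(log M)` vertices and colours `< k` the code has length `O(log² M)` and the
canonical form costs `M^{O(1)}` steps.
-- TODO(general form): canonical LABELING cosets `CL(X, G)` w.r.t. a permutation group `G`
-- given by generators, in time governed by the composition width of `G` (Babai–Luks §3), and
-- the sharper `exp(k^{1/2+o(1)})` dependence on `k`.

Not here: any algorithm (this is a named fact, discharged by proving `…_holds`); Babai's
quasipolynomial canonical forms (STOC 2019), which imply the same statement.

## References
* L. Babai, E. M. Luks, *Canonical labeling of graphs*, STOC 1983, 171–183,
  doi:10.1145/800061.808746 — Abstract and §4 (general graphs), §3 (string canonisation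
  w.r.t. a group; coloured graphs). [BabaiLuks1983]
* D. G. Corneil, M. K. Goldberg, *A non-factorial algorithm for canonical numbering of a
  graph*, J. Algorithms 5 (1984) 345–362. [CorneilGoldberg1984]
* S. Arora, B. Barak, *Computational Complexity* (2009), §0.1 (codes of graphs and tuples).
-/

namespace Literature.Computability.Complexity

open _root_.Computability

/-- The code of a vertex-coloured graph on `Fin k` with colours in `ℕ`: the pair
`⟨encodingGraph.encode ⟨k, G⟩, [col 0, …, col (k-1)] in binary⟩` (tree codes `boolPair`,
`encodingGraph`, `encodingFinVec encodingNatBool`). Its length is at least `k²` (the row-major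
adjacency matrix). [folklore] -/
noncomputable def colGraphCode (k : ℕ) (G : SimpleGraph (Fin k)) (col : Fin k → ℕ) : List Bool :=
  boolPair (encodingGraph.encode ⟨k, G⟩) ((encodingFinVec encodingNatBool k).encode col)

/-- Colour-preserving isomorphism of vertex-coloured graphs on `Fin k`: a graph isomorphism
`σ : G₁ ≃g G₂` with `c₂ (σ v) = c₁ v` for every vertex (Babai–Luks 1983, §1: isomorphisms
respecting a colouring = elements of the Young subgroup of the colour classes). [cite: BabaiLuks1983, §1] -/
def ColIso (k : ℕ) (G₁ : SimpleGraph (Fin k)) (c₁ : Fin k → ℕ) (G₂ : SimpleGraph (Fin k))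
    (c₂ : Fin k → ℕ) : Prop :=
  ∃ σ : G₁ ≃g G₂, ∀ v : Fin k, c₂ (σ v) = c₁ v

/-- Colour-preserving isomorphism is reflexive. [folklore] -/
theorem ColIso.refl (k : ℕ) (G : SimpleGraph (Fin k)) (c : Fin k → ℕ) : ColIso k G c G c :=
  ⟨SimpleGraph.Iso.refl, fun _ => rfl⟩

/-- Colour-preserving isomorphism is symmetric. [folklore] -/
theorem ColIso.symm {k : ℕ} {G₁ G₂ : SimpleGraph (Fin k)} {c₁ c₂ : Fin k → ℕ}
    (h : ColIso k G₁ c₁ G₂ c₂) : ColIso k G₂ c₂ G₁ c₁ := by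
  obtain ⟨σ, hσ⟩ := h
  refine ⟨σ.symm, fun v => ?_⟩
  have := hσ (σ.symm v)
  rw [RelIso.apply_symm_apply] at this
  exact this.symm

/-- Colour-preserving isomorphism is transitive. [folklore] -/
theorem ColIso.trans {k : ℕ} {G₁ G₂ G₃ : SimpleGraph (Fin k)} {c₁ c₂ c₃ : Fin k → ℕ}
    (h₁₂ : ColIso k G₁ c₁ G₂ c₂) (h₂₃ : ColIso k G₂ c₂ G₃ c₃) : ColIso k G₁ c₁ G₃ c₃ := by
  obtain ⟨σ, hσ⟩ := h₁₂
  obtain ⟨τ, hτ⟩ := h₂₃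
  exact ⟨σ.trans τ, fun v => by rw [RelIso.trans_apply, hτ, hσ]⟩

/-- **Canonical forms of vertex-coloured graphs in moderately exponential time**
(Babai–Luks 1983: canonical labeling, hence canonical forms, of graphs on `k` vertices — with
respect to any given vertex colouring — in `exp(k^{1/2+o(1)})` steps; Corneil–Goldberg 1984
give a combinatorial `c^k` canonisation). Stated in input-length form: there are a constant
`c` and a string map `can ∈ FTIME(N ↦ 2^{c √N})` which, on the code `colGraphCode k G col` of
any vertex-coloured graph, returns the code of a vertex-coloured graph on `Fin k` that is
colour-isomorphic to it, and which takes EQUAL values on codes of colour-isomorphic coloured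
graphs (so `can` is a complete invariant of colour-isomorphism on codes). The input-length
bound `2^{O(√N)}` follows from the paper's `poly(N) · exp(C √(k log k))` because the code
contains the `k × k` adjacency matrix (`N ≥ k²`); values of `can` off codes are unconstrained.
[cite: BabaiLuks1983, Abstract and §4 (canonical labeling of graphs in exp(n^{1/2+o(1)}) time)] -/
def babaiLuks1983_canonicalForm : Prop :=
  ∃ c : ℕ, ∃ can ∈ FTIME (fun N => 2 ^ (c * Nat.sqrt N)),
    (∀ (k : ℕ) (G : SimpleGraph (Fin k)) (col : Fin k → ℕ),
        ∃ (G' : SimpleGraph (Fin k)) (col' : Fin k → ℕ),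
          can (colGraphCode k G col) = colGraphCode k G' col' ∧ ColIso k G col G' col') ∧
    ∀ (k : ℕ) (G₁ : SimpleGraph (Fin k)) (c₁ : Fin k → ℕ) (G₂ : SimpleGraph (Fin k))
      (c₂ : Fin k → ℕ), ColIso k G₁ c₁ G₂ c₂ → can (colGraphCode k G₁ c₁) = can (colGraphCode k G₂ c₂)

/-- A canonical form is a complete invariant: under `babaiLuks1983_canonicalForm`, two codes of
coloured graphs have the same canonical form iff the coloured graphs are colour-isomorphic.
[cite: BabaiLuks1983, §1 (canonical forms vs. isomorphism testing)] -/
theorem babaiLuks1983_canonicalForm.complete (h : babaiLuks1983_canonicalForm) :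
    ∃ c : ℕ, ∃ can ∈ FTIME (fun N => 2 ^ (c * Nat.sqrt N)),
      ∀ (k : ℕ) (G₁ : SimpleGraph (Fin k)) (c₁ : Fin k → ℕ) (G₂ : SimpleGraph (Fin k))
        (c₂ : Fin k → ℕ),
        can (colGraphCode k G₁ c₁) = can (colGraphCode k G₂ c₂) ↔ ColIso k G₁ c₁ G₂ c₂ := by
  obtain ⟨c, can, hcan, hform, hinv⟩ := h
  refine ⟨c, can, hcan, fun k G₁ c₁ G₂ c₂ => ⟨fun heq => ?_, hinv k G₁ c₁ G₂ c₂⟩⟩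
  obtain ⟨G₁', c₁', h₁, hiso₁⟩ := hform k G₁ c₁
  obtain ⟨G₂', c₂', h₂, hiso₂⟩ := hform k G₂ c₂
  have hcode : colGraphCode k G₁' c₁' = colGraphCode k G₂' c₂' := by rw [← h₁, ← h₂, heq]
  -- codes are injective: decode both components
  have hG : (⟨k, G₁'⟩ : Σ n, SimpleGraph (Fin n)) = ⟨k, G₂'⟩ ∧ c₁' = c₂' := by
    have h1 := congrArg boolUnpair hcode
    simp only [colGraphCode, boolUnpair_boolPair, Prod.mk.injEq] at h1
    refine ⟨encodingGraph.encode_injective h1.1, (encodingFinVec encodingNatBool k).encode_injective h1.2⟩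
  obtain ⟨hG, rfl⟩ := hG
  have hG' : G₁' = G₂' := eq_of_heq (Sigma.mk.inj hG).2
  subst hG'
  exact hiso₁.trans hiso₂.symm

end Literature.Computability.Complexity
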